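import Summits.HodgeConjecture.HodgeConjecture.Theorems.MarkmanPartnerTransportPicardThreeK3SquaresKugaSatakeSelfDescent
import Literature.AlgebraicGeometry.Surfaces.GeometricGenusOneAssociatedK3Surface

/-!
# Route MarkmanPartnerTransport · crux `PicardThreeK3Squares` (stmt-HodgeConjecture-19652) —
# programme «KS-PAIR», step 1: a rational Hodge similitude `T(S) → T(S')` between TWO surfaces
# descends to a morphism of Hodge structures and TRANSPORTS a presentation of the transcendental
# part of `S` to one of `S'`

Programme «KS-SELF» (gen 14, `…KugaSatakeSelf*`) proved the SELF-similitude case of Varesco's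
theorem (Math. Z. 305 (2023), Thm. 5.3: Kuga–Satake for `S` and `S'` ⟹ every rational Hodge similitude
`T(S) → T(S')` is algebraic) from the Kuga–Satake hypothesis alone. Programme «KS-PAIR» (gen 15) does
the TWO-SURFACE case, i.e. proves the tree's named fact
`Surfaces.Varesco2023_transcendentalHodgeSimilitude_algebraic_of_kugaSatake_K3` in the kernel. This first
file is the Hodge-theoretic transport, for smooth projective surfaces `S`, `S'` (real Hodge models) and a
`ℂ`-linear `ψ : H²(S(ℂ); ℂ) → H²(S'(ℂ); ℂ)` mapping rational classes to rational classes and Hodge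
types of `S` to the same types of `S'`:

* `exists_ratLinear_ofRatClass_eq₂`, `exists_hom_ofRatClass_eq₂` — `ψ` DESCENDS to a morphism of
  `ℚ`-Hodge structures `Ψ : H²_B(S) → H²_B(S')` (`Ψ v ⊗ 1 = ψ (v ⊗ 1)`);
* `exists_hom_transcendental₂` — if `ψ(H²(S)) ⊥ N¹(S')`, `Ψ` restricts to `ψ_T : Hom T T'` between the
  sub-Hodge structures on the transcendental lattices `T(S)_ℚ`, `T(S')_ℚ`;
* `hom_transcendental_injective₂`, `finrank_transcendental_eq₂`, `hom_transcendental_bijective₂` —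
  if `ψ` is injective on `T(S)_ℂ = {y | y ⊥ N¹(S)}` and maps it ONTO `T(S')_ℂ`, then `ψ_T` is
  BIJECTIVE (injective; `dim_ℚ T(S)_ℚ = dim_ℂ T(S)_ℂ = dim_ℂ T(S')_ℂ = dim_ℚ T(S')_ℚ` through
  `Θ(ℂ ⊗ T(S)_ℚ) = T(S)_ℂ`);
* `exists_rat_multiplier₂` — a complex multiplier on `T(S)_ℂ` (`∫' ψy ∪ ψw = μ ∫ y ∪ w`) is a non-zero
  RATIONAL multiplier `m` on `T(S)_ℚ` (the intersection form of a presentation is non-degenerate);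
* `exists_isTranscendentalPartBetti_transport₂` — **THE TRANSPORTED PRESENTATION**: if `(T, P, ε, T ↪ H²_B(S))`
  presents the transcendental part of `S` (`IsTranscendentalPartBetti`) and `ψ_T` is bijective with
  rational multiplier `m ≠ 0`, then `(T, |m|·P, ε', T →ψ_T→ T' ↪ H²_B(S'))` presents the transcendental
  part of `S'` for a suitable sign `ε'` — the presentation at which the Kuga–Satake predicate OF `S'`
  will be instantiated (same abstract polarized Hodge structure as for `S`, rescaled).

THEOREMS ONLY (no definition, no named fact, no sorry); credits nothing to the Hodge conjecture.
Prover seat hodge-nonav-19652-p1 (gen 15), `--supports stmt-HodgeConjecture-19652`. References: Varesco, Math. Z. 305 (2023), Def. 1.2, §4 (proof of Thm. 4.5), Thm. 5.3; C. Voisin,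
*Hodge Theory I* (2002), §7.1.1, §7.3.1, §11.3; D. Huybrechts, *Lectures on K3 Surfaces* (2016), Ch. 3
Lemma 3.1; B. van Geemen, *Kuga-Satake varieties and the Hodge conjecture* (2000), §10.1–10.2.
-/

set_option linter.dupNamespace false

noncomputable section

namespace Summit.HodgeConjecture.HodgeConjecture.Theorems.MarkmanPartnerTransport.KugaSatakePair

open scoped TensorProduct
open CategoryTheory Literature.AlgebraicGeometry Literature.AlgebraicGeometry.Motives
open Literature.AlgebraicGeometry.HodgeTheory Literature.AlgebraicTopology.SingularHomology
open Literature.AlgebraicGeometry.Motives.HodgeStructure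
open Literature.AlgebraicGeometry.Surfaces
open Summit.HodgeConjecture.HodgeConjecture.Theorems.OddPrimeSquares
open Summit.HodgeConjecture.HodgeConjecture.Theorems.MarkmanPartnerTransport.TranscendentalPresentation
open Summit.HodgeConjecture.HodgeConjecture.Theorems.MarkmanPartnerTransport.KugaSatakeSelf

variable {S S' : SchemeOver ℂ}

/-- `H²_B(S)`: the weight-two `ℚ`-Hodge structure on `H²(S(ℂ); ℚ)` of the real Hodge model of `S`. -/
local notation3 "H²[" hS "]" =>
  bettiTwoHodgeStructure hS (BettiUniverse.realHodgeModel exists_isReal_hodgeModel_holds hS)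
    (BettiUniverse.realHodgeModel_isHodgeSymmetric exists_isReal_hodgeModel_holds hS)

/-- `T(S)_ℚ = Hdg¹^⊥ ⊆ H²(S(ℂ); ℚ)`. -/
local notation3 "T[" hS "]" =>
  transcendentalLatticeBetti hS (BettiUniverse.realHodgeModel exists_isReal_hodgeModel_holds hS)
    (BettiUniverse.realHodgeModel_isHodgeSymmetric exists_isReal_hodgeModel_holds hS)

/-- `Θ : ℂ ⊗_ℚ H²(S(ℂ); ℚ) → H²(S(ℂ); ℂ)`. -/
local notation3 "Θ[" S "]" => ofRatClassBaseChange (Motives.ComplexPoints S) (2 * 1)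

/-- `ι : H²(S(ℂ); ℚ) → H²(S(ℂ); ℂ)`, the rational lattice. -/
local notation3 "ι[" S "]" => ofRatClass (Motives.ComplexPoints S) (2 * 1)

/-- `Transc[S, y]`: `y` is cup-orthogonal to `N¹(S) = algebraicClasses S 1`. Local notation only. -/
local notation3 (prettyPrint := false) "Transc[" S ", " y "]" =>
  (∀ d ∈ algebraicClasses S 1, cupProduct (rfl : 2 * 1 + 2 * 1 = 2 * 2) y d = 0)

/-! ### §1 Rational descent of a rational `ℂ`-linear map `H²(S) → H²(S')` -/

/-- **A `ℂ`-linear map `H²(S(ℂ); ℂ) → H²(S'(ℂ); ℂ)` mapping rational classes to rational classes is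
the complexification of a unique `ℚ`-linear `Ψ : H²(S(ℂ); ℚ) → H²(S'(ℂ); ℚ)`**: `Ψ v ⊗ 1 = ψ(v ⊗ 1)`
(the rational lattice of `S'` is injective). [cite: VoisinHodgeI2002, §7.1.1 and §11.3.1] -/
theorem exists_ratLinear_ofRatClass_eq₂ (ψ : complexBetti S (2 * 1) →ₗ[ℂ] complexBetti S' (2 * 1))
    (h1 : ∀ y, IsRationalClass y → IsRationalClass (ψ y)) :
    ∃ Ψ : bettiCohomology S (2 * 1) →ₗ[ℚ] bettiCohomology S' (2 * 1), ∀ v, ι[S'] (Ψ v) = ψ (ι[S] v) := by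
  have hex : ∀ v : bettiCohomology S (2 * 1), ∃ w : bettiCohomology S' (2 * 1), ι[S'] w = ψ (ι[S] v) :=
    fun v => (isRationalClass_iff_mem_range_ofRatClass _).1 (h1 _ (isRationalClass_ofRatClass _))
  choose f hf using hex
  have hinj := ofRatClass_injective (Y := Motives.ComplexPoints S') (2 * 1)
  refine ⟨{ toFun := f, map_add' := fun v w => hinj ?_, map_smul' := fun q v => hinj ?_ }, hf⟩
  · rw [map_add, hf, hf, hf, map_add, map_add]
  · rw [hf, ofRatClass_smul, ofRatClass_smul, map_smul, hf, RingHom.id_apply]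

/-- The complexification of the descent is `ψ`: `Θ' (Ψ ⊗ ℂ) x = ψ (Θ x)`. [folklore] -/
theorem ofRatClassBaseChange_baseChange_eq₂ {ψ : complexBetti S (2 * 1) →ₗ[ℂ] complexBetti S' (2 * 1)}
    {Ψ : bettiCohomology S (2 * 1) →ₗ[ℚ] bettiCohomology S' (2 * 1)}
    (hΨ : ∀ v, ι[S'] (Ψ v) = ψ (ι[S] v)) (x : ℂ ⊗[ℚ] bettiCohomology S (2 * 1)) :
    Θ[S'] (Ψ.baseChange ℂ x) = ψ (Θ[S] x) := by
  induction x using TensorProduct.induction_on with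
  | zero => simp only [map_zero]
  | tmul c v => rw [LinearMap.baseChange_tmul, ofRatClassBaseChange_tmul, ofRatClassBaseChange_tmul, hΨ, map_smul]
  | add x y hx hy => rw [map_add, map_add, map_add, map_add, hx, hy]

/-! ### §2 The descent is a morphism of Hodge structures `H²_B(S) → H²_B(S')` -/

/-- **A rational map `H²(S(ℂ); ℂ) → H²(S'(ℂ); ℂ)` carrying classes of type `(i, j)` on `S` to classes
of type `(i, j)` on `S'` descends to a morphism of Hodge structures `H²_B(S) → H²_B(S')`**: the Hodge
filtrations `F^p = ⊕_{a ≥ p} Θ⁻¹H^{a,2-a}` (`HodgeModel.ratF_eq_iSup`) correspond under `Ψ` (types read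
in the real models by `hodgePQ_independent_of_hodgeModel_holds`). [cite: VoisinHodgeI2002, §7.3.1 and §7.1.1] -/
theorem exists_hom_ofRatClass_eq₂ (hS : IsSmoothProjective 2 S) (hS' : IsSmoothProjective 2 S')
    (ψ : complexBetti S (2 * 1) →ₗ[ℂ] complexBetti S' (2 * 1))
    (h1 : ∀ y, IsRationalClass y → IsRationalClass (ψ y))
    (h2 : ∀ (i j : ℕ) y, IsOfHodgeType 2 S (2 * 1) i j y → IsOfHodgeType 2 S' (2 * 1) i j (ψ y)) :
    ∃ Ψ : Hom (H²[hS]) (H²[hS']), ∀ v, ι[S'] (Ψ.toLinearMap v) = ψ (ι[S] v) := by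
  obtain ⟨Ψ, hΨ⟩ := exists_ratLinear_ofRatClass_eq₂ ψ h1
  set A := BettiUniverse.realHodgeModel exists_isReal_hodgeModel_holds hS with hA
  set A' := BettiUniverse.realHodgeModel exists_isReal_hodgeModel_holds hS' with hA'
  have hI := hodgePQ_independent_of_hodgeModel_holds
  refine ⟨{ toLinearMap := Ψ, map_F_le := fun r => ?_ }, hΨ⟩
  rintro _ ⟨x, hx, rfl⟩
  have hF : (H²[hS]).F r = A.ratF hS (2 * 1) r := rfl
  have hF' : (H²[hS']).F r = A'.ratF hS' (2 * 1) r := rfl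
  rw [SetLike.mem_coe, hF, HodgeModel.ratF_eq_iSup] at hx
  rw [hF', HodgeModel.ratF_eq_iSup]
  induction hx using Submodule.iSup_induction' with
  | mem pq x hx =>
    by_cases hr : r ≤ (pq.1.1 : ℤ)
    · rw [iSup_pos hr, HodgeModel.mem_ratPiece_iff, HodgeModel.complexification_apply] at hx
      have hty : IsOfHodgeType 2 S (2 * 1) pq.1.1 pq.1.2 (Θ[S] x) := ⟨A, hx⟩
      have hty' := h2 _ _ _ hty
      rw [← ofRatClassBaseChange_baseChange_eq₂ hΨ] at hty'
      obtain ⟨B', hB'⟩ := hty'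
      have h3 := hI 2 S' hS' B' A' (2 * 1) pq.1.1 pq.1.2 _ hB'
      refine Submodule.mem_iSup_of_mem pq (Submodule.mem_iSup_of_mem hr ?_)
      rw [HodgeModel.mem_ratPiece_iff, HodgeModel.complexification_apply]
      exact h3
    · rw [iSup_neg hr, Submodule.mem_bot] at hx
      rw [hx, map_zero]
      exact Submodule.zero_mem _
  | zero => rw [map_zero]; exact Submodule.zero_mem _
  | add x y _ _ hx hy => rw [map_add]; exact Submodule.add_mem _ hx hy

/-! ### §3 Restriction to the transcendental lattices -/

/-- **A Hodge morphism `T(S)_ℚ → T(S')_ℚ` from `ψ`.** For sub-Hodge structures `T ⊆ H²_B(S)`,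
`T' ⊆ H²_B(S')` with underlying spaces `T(S)_ℚ`, `T(S')_ℚ` and `ψ` rational, type-preserving with image
cup-orthogonal to `N¹(S')`, the descent `Ψ` maps `T(S)_ℚ` into `T(S')_ℚ` and restricts to
`ψ_T : Hom T T'` with `(ψ_T t) ⊗ 1 = ψ(t ⊗ 1)`. [cite: VoisinHodgeI2002, §7.3.1] [cite: Huybrechts2016K3, Ch. 3 Lemma 3.1] -/
theorem exists_hom_transcendental₂ (hS : IsSmoothProjective 2 S) (hS' : IsSmoothProjective 2 S')
    (T : SubHodgeStructure (H²[hS])) (T' : SubHodgeStructure (H²[hS'])) (hT' : T'.toSubmodule = T[hS'])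
    (ψ : complexBetti S (2 * 1) →ₗ[ℂ] complexBetti S' (2 * 1))
    (h1 : ∀ y, IsRationalClass y → IsRationalClass (ψ y))
    (h2 : ∀ (i j : ℕ) y, IsOfHodgeType 2 S (2 * 1) i j y → IsOfHodgeType 2 S' (2 * 1) i j (ψ y))
    (h4 : ∀ y : complexBetti S (2 * 1), Transc[S', ψ y]) :
    ∃ ψT : Hom T.toHodgeStructure T'.toHodgeStructure,
      ∀ t : T.toSubmodule, ι[S'] ((ψT.toLinearMap t : T'.toSubmodule) : bettiCohomology S' (2 * 1)) =
        ψ (ι[S] (t : bettiCohomology S (2 * 1))) := by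
  obtain ⟨Ψ, hΨ⟩ := exists_hom_ofRatClass_eq₂ hS hS' ψ h1 h2
  have hmem : ∀ t : T.toSubmodule, (Ψ.comp T.subtypeHom).toLinearMap t ∈ T'.toSubmodule := by
    intro t
    have h : Ψ.toLinearMap (t : bettiCohomology S (2 * 1)) ∈ T[hS'] := by
      rw [mem_transcendental_iff_transc hS', hΨ]
      exact h4 _
    exact (le_of_eq hT'.symm : T[hS'] ≤ T'.toSubmodule) h
  exact ⟨(Ψ.comp T.subtypeHom).codRestrict T' hmem, fun t => hΨ _⟩

/-! ### §4 Bijectivity of the restriction -/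

section Restriction

variable {hS : IsSmoothProjective 2 S} {hS' : IsSmoothProjective 2 S'}
  {T : SubHodgeStructure (H²[hS])} {T' : SubHodgeStructure (H²[hS'])}
  {ψ : complexBetti S (2 * 1) →ₗ[ℂ] complexBetti S' (2 * 1)}
  {ψT : Hom T.toHodgeStructure T'.toHodgeStructure}

/-- `ψ_T` is injective when `ψ` is injective on `T(S)_ℂ`. [folklore] -/
theorem hom_transcendental_injective₂ (hT : T.toSubmodule = T[hS])
    (hψT : ∀ t : T.toSubmodule, ι[S'] ((ψT.toLinearMap t : T'.toSubmodule) : bettiCohomology S' (2 * 1)) =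
      ψ (ι[S] (t : bettiCohomology S (2 * 1))))
    (hinj : ∀ y : complexBetti S (2 * 1), Transc[S, y] → ψ y = 0 → y = 0) :
    Function.Injective ψT.toLinearMap := by
  rw [injective_iff_map_eq_zero]
  intro t ht
  have h0 : ψ (ι[S] (t : bettiCohomology S (2 * 1))) = 0 := by
    rw [← hψT, ht, Submodule.coe_zero, map_zero]
  have htr : Transc[S, ι[S] (t : bettiCohomology S (2 * 1))] :=
    (mem_transcendental_iff_transc hS _).1 (hT ▸ t.2)
  have h1 := hinj _ htr h0
  apply Subtype.ext
  exact ofRatClass_injective (Y := Motives.ComplexPoints S) (2 * 1) (by rw [h1, Submodule.coe_zero, map_zero])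

end Restriction

/-- **`dim_ℚ T(S)_ℚ = dim_ℂ T(S)_ℂ`**: `Θ ∘ (ι_T ⊗ ℂ)` is a `ℂ`-linear bijection of `ℂ ⊗_ℚ T(S)_ℚ` onto
the cup-transcendental subspace `T(S)_ℂ = {y | y ⊥ N¹(S)}` (`= Surfaces.transcendentalSubspace S`;
injective by flatness and injectivity of `Θ`, surjective by `exists_baseChange_eq_of_transc`).
[cite: Huybrechts2016K3, Ch. 3 Lemma 3.1] [cite: VoisinHodgeI2002, §7.1.1] -/
theorem finrank_transcendental_eq_finrank_transcendentalSubspace (hS : IsSmoothProjective 2 S)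
    (T : SubHodgeStructure (H²[hS])) (hT : T.toSubmodule = T[hS]) :
    Module.finrank ℚ T.toSubmodule = Module.finrank ℂ (transcendentalSubspace S) := by
  -- the comparison map `ℂ ⊗ T → transcendentalSubspace S`
  let f : ℂ ⊗[ℚ] T.toSubmodule →ₗ[ℂ] complexBetti S (2 * 1) := (Θ[S]) ∘ₗ T.toSubmodule.subtype.baseChange ℂ
  have hf : ∀ x, f x = Θ[S] (T.toSubmodule.subtype.baseChange ℂ x) := fun _ => rfl
  have hmem : ∀ x, f x ∈ transcendentalSubspace S := fun x =>
    (mem_transcendentalSubspace_iff_forall_algebraicClasses hS _).2 (by rw [hf]; exact transc_of_baseChange hS T hT x)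
  have hinj : Function.Injective (f.codRestrict (transcendentalSubspace S) hmem) := by
    intro x y hxy
    have h := congrArg Subtype.val hxy
    simp only [LinearMap.codRestrict_apply] at h
    exact baseChange_injective_of_injective T.toSubmodule.injective_subtype
      (ofRatClassBaseChange_injective _ _ h)
  have hsurj : Function.Surjective (f.codRestrict (transcendentalSubspace S) hmem) := by
    rintro ⟨y, hy⟩
    obtain ⟨x, hx⟩ := exists_baseChange_eq_of_transc hS T hT
      ((mem_transcendentalSubspace_iff_forall_algebraicClasses hS y).1 hy)
    exact ⟨x, Subtype.ext hx⟩
  rw [← (LinearEquiv.ofBijective _ ⟨hinj, hsurj⟩).finrank_eq, Module.finrank_baseChange]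

section Bijective

variable {hS : IsSmoothProjective 2 S} {hS' : IsSmoothProjective 2 S'}
  {T : SubHodgeStructure (H²[hS])} {T' : SubHodgeStructure (H²[hS'])}
  {ψ : complexBetti S (2 * 1) →ₗ[ℂ] complexBetti S' (2 * 1)}
  {ψT : Hom T.toHodgeStructure T'.toHodgeStructure}

/-- **`dim_ℚ T(S)_ℚ = dim_ℚ T(S')_ℚ`** when `ψ` maps `T(S)_ℂ` injectively onto `T(S')_ℂ` (both equal
the common complex dimension). [cite: Varesco2023, Def. 1.2] [cite: Huybrechts2016K3, Ch. 3 Lemma 3.1] -/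
theorem finrank_transcendental_eq₂ (hT : T.toSubmodule = T[hS]) (hT' : T'.toSubmodule = T[hS'])
    (hψ : ∀ y : complexBetti S (2 * 1), Transc[S, y] → Transc[S', ψ y])
    (hinj : ∀ y : complexBetti S (2 * 1), Transc[S, y] → ψ y = 0 → y = 0)
    (hsurj : ∀ y' : complexBetti S' (2 * 1), Transc[S', y'] → ∃ y, Transc[S, y] ∧ ψ y = y') :
    Module.finrank ℚ T.toSubmodule = Module.finrank ℚ T'.toSubmodule := by
  rw [finrank_transcendental_eq_finrank_transcendentalSubspace hS T hT,
    finrank_transcendental_eq_finrank_transcendentalSubspace hS' T' hT']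
  have hmem : ∀ y : transcendentalSubspace S, ψ (y : complexBetti S (2 * 1)) ∈ transcendentalSubspace S' :=
    fun y => (mem_transcendentalSubspace_iff_forall_algebraicClasses hS' _).2
      (hψ _ ((mem_transcendentalSubspace_iff_forall_algebraicClasses hS _).1 y.2))
  let g : transcendentalSubspace S →ₗ[ℂ] transcendentalSubspace S' :=
    (ψ ∘ₗ (transcendentalSubspace S).subtype).codRestrict _ hmem
  have hginj : Function.Injective g := by
    rintro ⟨x, hx⟩ ⟨y, hy⟩ hxy
    have h := congrArg Subtype.val hxy
    simp only [g, LinearMap.codRestrict_apply, LinearMap.comp_apply, Submodule.subtype_apply] at h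
    apply Subtype.ext
    have hxy' : Transc[S, x - y] := by
      intro d hd
      rw [map_sub, LinearMap.sub_apply, (mem_transcendentalSubspace_iff_forall_algebraicClasses hS x).1 hx d hd,
        (mem_transcendentalSubspace_iff_forall_algebraicClasses hS y).1 hy d hd, sub_zero]
    exact sub_eq_zero.1 (hinj _ hxy' (by rw [map_sub, h, sub_self]))
  have hgsurj : Function.Surjective g := by
    rintro ⟨y', hy'⟩
    obtain ⟨y, hy, rfl⟩ := hsurj y' ((mem_transcendentalSubspace_iff_forall_algebraicClasses hS' y').1 hy')
    exact ⟨⟨y, (mem_transcendentalSubspace_iff_forall_algebraicClasses hS y).2 hy⟩, Subtype.ext rfl⟩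
  exact (LinearEquiv.ofBijective g ⟨hginj, hgsurj⟩).finrank_eq

/-- **`ψ_T : T(S)_ℚ → T(S')_ℚ` is BIJECTIVE** when `ψ` maps `T(S)_ℂ` injectively onto `T(S')_ℂ`
(injective between `ℚ`-spaces of the same finite dimension). [cite: Varesco2023, Def. 1.2]
[cite: Huybrechts2016K3, Ch. 3 Lemma 3.1] -/
theorem hom_transcendental_bijective₂ (hT : T.toSubmodule = T[hS]) (hT' : T'.toSubmodule = T[hS'])
    (hψT : ∀ t : T.toSubmodule, ι[S'] ((ψT.toLinearMap t : T'.toSubmodule) : bettiCohomology S' (2 * 1)) =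
      ψ (ι[S] (t : bettiCohomology S (2 * 1))))
    (hψ : ∀ y : complexBetti S (2 * 1), Transc[S, y] → Transc[S', ψ y])
    (hinj : ∀ y : complexBetti S (2 * 1), Transc[S, y] → ψ y = 0 → y = 0)
    (hsurj : ∀ y' : complexBetti S' (2 * 1), Transc[S', y'] → ∃ y, Transc[S, y] ∧ ψ y = y') :
    Function.Bijective ψT.toLinearMap := by
  haveI := BettiUniverse.finite hS (2 * 1); haveI := BettiUniverse.finite hS' (2 * 1)
  haveI := Module.Finite.of_injective T.toSubmodule.subtype T.toSubmodule.injective_subtype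
  haveI := Module.Finite.of_injective T'.toSubmodule.subtype T'.toSubmodule.injective_subtype
  have hi := hom_transcendental_injective₂ hT hψT hinj
  exact ⟨hi, (LinearMap.injective_iff_surjective_of_finrank_eq_finrank
    (finrank_transcendental_eq₂ hT hT' hψ hinj hsurj)).1 hi⟩

end Bijective

/-! ### §5 The multiplier is rational -/

/-- `(∫_S a ∪ b : ℚ) ⊗ 1 = ∫_ℂ (a ⊗ 1) ∪ (b ⊗ 1)`: the rational intersection number read in `ℂ`.
[cite: VoisinHodgeI2002, §7.1.2] -/
theorem algebraMap_cupPairingBetti (hS : IsSmoothProjective 2 S) (a b : bettiCohomology S (2 * 1)) :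
    ((cupPairingBetti hS a b : ℚ) : ℂ) =
      traceC hS (cupProduct (rfl : 2 * 1 + 2 * 1 = 2 * 2) (ι[S] a) (ι[S] b)) := by
  rw [cupPairingBetti_apply, ofRatClass_eq_ringChange, ofRatClass_eq_ringChange,
    ← singularCohomology.ringChange_cupProduct, ← ofRatClass_eq_ringChange, traceC_ofRatClass]
  rfl

/-- **A complex multiplier on `T(S)_ℂ` is a non-zero rational multiplier on `T(S)_ℚ`.** Let
`(T, P, ε, T ↪ H²_B(S))` present the transcendental part of `S`, `ψ_T : Hom T T'` the restriction of `ψ`,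
and `∫_{S'} ψy ∪ ψw = μ ∫_S y ∪ w` on `T(S)_ℂ` with `μ ≠ 0`. Then for some rational `m ≠ 0`,
`∫_{S'} ψ_T a ∪ ψ_T b = m ∫_S a ∪ b` for all `a, b ∈ T(S)_ℚ` (`P = ε∫` is non-degenerate and `T ≠ 0`,
so some `∫ a ∪ b ≠ 0` and `μ` is a quotient of two rationals). [cite: Varesco2023, Def. 1.2 and Rem. 2.2]
[cite: Huybrechts2016K3, Ch. 3 Lemma 3.1] -/
theorem exists_rat_multiplier₂ (hS : IsSmoothProjective 2 S) (hS' : IsSmoothProjective 2 S')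
    {T : SubHodgeStructure (H²[hS])} {T' : SubHodgeStructure (H²[hS'])} (hT : T.toSubmodule = T[hS])
    {P : T.toHodgeStructure.Polarization} {ε : ℤˣ}
    (hj : IsTranscendentalPartBetti hS _ _ T.toHodgeStructure P ε T.subtypeHom)
    (hT0 : T.toSubmodule ≠ ⊥)
    {ψ : complexBetti S (2 * 1) →ₗ[ℂ] complexBetti S' (2 * 1)}
    {ψT : Hom T.toHodgeStructure T'.toHodgeStructure}
    (hψT : ∀ t : T.toSubmodule, ι[S'] ((ψT.toLinearMap t : T'.toSubmodule) : bettiCohomology S' (2 * 1)) =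
      ψ (ι[S] (t : bettiCohomology S (2 * 1))))
    {μ : ℂ} (hμ : μ ≠ 0)
    (hmul : ∀ y w : complexBetti S (2 * 1), Transc[S, y] → Transc[S, w] →
      traceC hS' (cupProduct (rfl : 2 * 1 + 2 * 1 = 2 * 2) (ψ y) (ψ w)) =
        μ * traceC hS (cupProduct (rfl : 2 * 1 + 2 * 1 = 2 * 2) y w)) :
    ∃ m : ℚ, m ≠ 0 ∧ ∀ a b : T.toSubmodule,
      cupPairingBetti hS' ((ψT.toLinearMap a : T'.toSubmodule) : bettiCohomology S' (2 * 1))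
          ((ψT.toLinearMap b : T'.toSubmodule) : bettiCohomology S' (2 * 1)) =
        m * cupPairingBetti hS (a : bettiCohomology S (2 * 1)) (b : bettiCohomology S (2 * 1)) := by
  obtain ⟨-, -, hform⟩ := hj
  -- the complex identity on `T(S)_ℚ`
  have key : ∀ a b : T.toSubmodule,
      ((cupPairingBetti hS' ((ψT.toLinearMap a : T'.toSubmodule) : bettiCohomology S' (2 * 1))
          ((ψT.toLinearMap b : T'.toSubmodule) : bettiCohomology S' (2 * 1)) : ℚ) : ℂ) =
        μ * ((cupPairingBetti hS (a : bettiCohomology S (2 * 1)) (b : bettiCohomology S (2 * 1)) : ℚ) : ℂ) := by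
    intro a b
    rw [algebraMap_cupPairingBetti, algebraMap_cupPairingBetti, hψT, hψT]
    exact hmul _ _ ((mem_transcendental_iff_transc hS _).1 (hT ▸ a.2))
      ((mem_transcendental_iff_transc hS _).1 (hT ▸ b.2))
  -- some intersection number on `T(S)_ℚ` is non-zero
  obtain ⟨a₀, b₀, hab⟩ : ∃ a b : T.toSubmodule,
      cupPairingBetti hS (a : bettiCohomology S (2 * 1)) (b : bettiCohomology S (2 * 1)) ≠ 0 := by
    obtain ⟨a, ha⟩ := (Submodule.ne_bot_iff _).1 hT0
    obtain ⟨ha, ha0⟩ := ha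
    by_contra hall
    push Not at hall
    have hPa : ∀ b : T.toSubmodule, P.form ⟨a, ha⟩ b = 0 := by
      intro b
      rw [hform]
      simp only [LinearMap.smul_apply, LinearMap.compl₁₂_apply, smul_eq_mul]
      rw [show (T.subtypeHom.toLinearMap ⟨a, ha⟩ : bettiCohomology S (2 * 1)) = a from rfl,
        show (T.subtypeHom.toLinearMap b : bettiCohomology S (2 * 1)) = b from rfl, hall ⟨a, ha⟩ b, mul_zero]
    have h0 : (⟨a, ha⟩ : T.toSubmodule) = 0 := P.nondegenerate.1 _ hPa
    exact ha0 (congrArg Subtype.val h0)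
  -- the multiplier
  set q₁ := cupPairingBetti hS' ((ψT.toLinearMap a₀ : T'.toSubmodule) : bettiCohomology S' (2 * 1))
    ((ψT.toLinearMap b₀ : T'.toSubmodule) : bettiCohomology S' (2 * 1)) with hq₁
  set q₂ := cupPairingBetti hS (a₀ : bettiCohomology S (2 * 1)) (b₀ : bettiCohomology S (2 * 1)) with hq₂
  have hμq : μ = ((q₁ / q₂ : ℚ) : ℂ) := by
    have h := key a₀ b₀
    rw [← hq₁, ← hq₂] at h
    have hq₂' : ((q₂ : ℚ) : ℂ) ≠ 0 := by exact_mod_cast hab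
    rw [Rat.cast_div, eq_div_iff hq₂', h]
  refine ⟨q₁ / q₂, ?_, fun a b => ?_⟩
  · intro h0
    apply hμ
    rw [hμq, h0, Rat.cast_zero]
  · have h := key a b
    rw [hμq, ← Rat.cast_mul] at h
    exact_mod_cast h

/-! ### §6 The transported presentation of the transcendental part of `S'` -/

/-- **THE TRANSPORTED PRESENTATION.** Let `(T, P, ε, T ↪ H²_B(S))` present the transcendental part of
`S` (`IsTranscendentalPartBetti`), `T' ⊆ H²_B(S')` the sub-Hodge structure on `T(S')_ℚ`, and
`ψ_T : Hom T T'` BIJECTIVE with rational multiplier `m ≠ 0` (`∫' ψ_T a ∪ ψ_T b = m ∫ a ∪ b`). Then for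
the sign `ε' = ε · sign(m)` the datum `(T, |m|·P, ε', T →ψ_T→ T' ↪ H²_B(S'))` presents the
transcendental part of `S'`: the composite is injective onto `T(S')_ℚ` and
`|m| P(a, b) = |m| ε ∫ a ∪ b = ε' ∫' ψ_T a ∪ ψ_T b`. This is the presentation at which the Kuga–Satake
predicate of `S'` is instantiated (Varesco: "`ψ` induces an isomorphism between the Kuga–Satake
varieties", read as a change of presentation on one abstract Hodge structure).
[cite: Varesco2023, §4 (proof of Thm. 4.5) and Lemma 3.3] [cite: vanGeemen2000KugaSatakeHC, §10.1–10.2] -/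
theorem exists_isTranscendentalPartBetti_transport₂ (hS : IsSmoothProjective 2 S) (hS' : IsSmoothProjective 2 S')
    {T : SubHodgeStructure (H²[hS])} {T' : SubHodgeStructure (H²[hS'])} (hT' : T'.toSubmodule = T[hS'])
    {P : T.toHodgeStructure.Polarization} {ε : ℤˣ}
    (hj : IsTranscendentalPartBetti hS _ _ T.toHodgeStructure P ε T.subtypeHom)
    {ψT : Hom T.toHodgeStructure T'.toHodgeStructure} (hbij : Function.Bijective ψT.toLinearMap)
    {m : ℚ} (hm : m ≠ 0)
    (hmul : ∀ a b : T.toSubmodule,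
      cupPairingBetti hS' ((ψT.toLinearMap a : T'.toSubmodule) : bettiCohomology S' (2 * 1))
          ((ψT.toLinearMap b : T'.toSubmodule) : bettiCohomology S' (2 * 1)) =
        m * cupPairingBetti hS (a : bettiCohomology S (2 * 1)) (b : bettiCohomology S (2 * 1))) :
    ∃ ε' : ℤˣ, IsTranscendentalPartBetti hS' _ _ T.toHodgeStructure (P.smul |m| (abs_pos.2 hm)) ε'
      (T'.subtypeHom.comp ψT) := by
  obtain ⟨-, -, hform⟩ := hj
  -- the sign `ε' = ε · sign m`
  obtain ⟨ε', hε'⟩ : ∃ ε' : ℤˣ, ((ε' : ℤ) : ℚ) * m = ((ε : ℤ) : ℚ) * |m| := by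
    rcases lt_or_gt_of_ne hm with h | h
    · refine ⟨-ε, ?_⟩
      rw [abs_of_neg h, Units.val_neg, Int.cast_neg]
      ring
    · exact ⟨ε, by rw [abs_of_pos h]⟩
  refine ⟨ε', ?_, ?_, ?_⟩
  · exact T'.subtypeHom_injective.comp hbij.1
  · rw [Hom.comp_toLinearMap, LinearMap.range_comp, LinearMap.range_eq_top.2 hbij.2, Submodule.map_top,
      SubHodgeStructure.subtypeHom_toLinearMap, Submodule.range_subtype, hT']
  · refine LinearMap.ext fun a => LinearMap.ext fun b => ?_
    change |m| * P.form a b = _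
    rw [hform]
    simp only [LinearMap.smul_apply, LinearMap.compl₁₂_apply, smul_eq_mul]
    change |m| * (((ε : ℤ) : ℚ) * cupPairingBetti hS (a : bettiCohomology S (2 * 1)) (b : bettiCohomology S (2 * 1))) =
      ((ε' : ℤ) : ℚ) * cupPairingBetti hS' ((ψT.toLinearMap a : T'.toSubmodule) : bettiCohomology S' (2 * 1))
        ((ψT.toLinearMap b : T'.toSubmodule) : bettiCohomology S' (2 * 1))
    rw [hmul]
    linear_combination (-(cupPairingBetti hS (a : bettiCohomology S (2 * 1)) (b : bettiCohomology S (2 * 1)))) * hε'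

end Summit.HodgeConjecture.HodgeConjecture.Theorems.MarkmanPartnerTransport.KugaSatakePair

end
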